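import Literature.AnabelianGeometry.EtaleTheta.Discharge.Sec1Rmk131ModelChiNoHalf
import Literature.AnabelianGeometry.EtaleTheta.EtaleThetaDataOfClass
import Literature.AnabelianGeometry.EtaleTheta.SettingModelChiSectionPoints
import HarnessLib

/-!
# [EtTh] Rmk. 1.3.1 as TYPED (`ThetaSetting.Rmk131`) HOLDS at an étale-theta datum over the genuine Kummer
# datum of the χ-model: `η̈ := log(Ü)` with the honest-degenerate `½`-groups (F-0523 instance form, proof-only)

S. Mochizuki, *The étale theta function …*, Publ. RIMS **45** (2009) [EtTh], §1, Rmk. 1.3.1, PRIMS PDF p. 21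
l. 31–33 [cite: MochizukiEtTh2009, Rmk 1.3.1 p.21]: "the denominators `½` in Proposition 1.3 are by no means
superfluous: Indeed, this follows immediately from the fact that the divisor `D₁` on `Ÿ` clearly does not descend
to `Y`"; Prop. 1.5 p. 23 l. 64 "`log(Ü) = ½ · log(U)`", l. 79 "`η̈^Θ ↦ η̈^Θ − 2a · log(Ü) − …`".

PROOF-ONLY companion (abc-iut cell, block F, seat abc-iut-f-117 gen 4; FACT-LIST row F-0523 `ThetaSetting.Rmk131`,
instance form AT A NAMED DATUM; no `def`, no instance, no Prop fact).  abc-iut-L2-t6's generic constructor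
`KummerData.etaleThetaDataOfClass E₀ η` (`EtaleThetaDataOfClass.lean`, F7a) turns a Kummer datum and ONE class
`η ∈ H¹(Π^tp_Ÿ, Δ_Θ)` into an `EtaleThetaData` whose `½`-groups are honest-degenerate (`H¹(Π^tp_Y, ½Δ_Θ) :=
H¹(Π^tp_Ÿ, Δ_Θ)`, `ofIntegralY := res_{Ÿ ≤ Y}`, unit action = Kummer classes); there
`Rmk131 ↔ «no unit translate κ(a) · η is the restriction of a class on Π^tp_Y»` (`rmk131_etaleThetaDataOfClass_iff`),
and L2-t6 recorded the token «Rmk131 FAILS at the degenerate data when `η̈` extends to `Y`».  THIS FILE supplies the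
positive half at the χ-model over abc-iut-w5-d171's GENUINE Kummer datum `kummerDataχ`:

* `SettingModel.rmk131_etaleThetaDataOfClass_infl_logUddχ` — **`Rmk131` HOLDS for `η̈ := log(Ü)`** (w5-d171's class,
  inflated to `Π^tp_Ÿ`): no unit translate `κ(a) · log(Ü)` descends to `Π^tp_Y`.  ARITHMETIC: evaluate a descent
  `κ(a) · log(Ü) = x|_Ÿ` at the geometric element `b² ∈ Π^tp_Ÿ` — Kummer cocycles of constants vanish there
  (`KummerCore.kummerContMap_apply_eq_one`, the generic form of abc-iut-f-139's `…_of_kumYdd_eq_mk`), the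
  `log(Ü)`-cocycle is `c^{ŷ(b²)/2} = c^{ι(1)}`, and a tempered cocycle `x` on `Π^tp_Y` has `x(b²) = x(b)²` (`b ∈ Π^tp_Y`
  centralises `Δ_Θ`) — so `c` would be a square in `Δ_Θ ≅ Ẑ` (`sq_ne_deltaThetaCoordχ_iotaZ_one`, the parity
  obstruction of `Sec1Rmk131ModelChiNoHalf.lean`);
* `SettingModel.rmk131_etaleThetaDataOfClass_or_mul_logUddχ` — the **`½`-DICHOTOMY**: for EVERY class `η̈`, the typed
  Rmk. 1.3.1 holds for `η̈` or for `η̈ · log(Ü)` over `kummerDataχ` — multiplying by `log(Ü) = ½·log(U)` flips a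
  descending class into a non-descending one; in particular `not_rmk131_…_one` / `rmk131_…` for `η̈ = 1` vs. `log(Ü)`.

* appended: the SAME three statements at abc-iut-L2-t6's F7b datum of record `etaleThetaDataχSec p η̈` (section Kummer
  datum, `SettingModelChiSectionPoints.lean`) — its unit Kummer classes on `Π^tp_Ÿ` coincide with the core datum's
  (L2-t6's retraction `kumOfSection_toKddHatOfSection`): `rmk131_etaleThetaDataχSec_infl_logUddχ`,
  `not_rmk131_etaleThetaDataχSec_one`, `rmk131_etaleThetaDataχSec_or_mul_logUddχ`.

So the E-indexed census reads, at `(modelχ, kummerDataχ)`: «Rmk131: WITNESSED-TRUE (η̈ := log(Ü)) and WITNESSED-FALSE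
(η̈ := 1) at the honest-degenerate `½`-groups» — the typed predicate does detect the `½` of Rmk. 1.3.1 through the
class `log(Ü)`, even though the degenerate `½`-groups carry no divisor theory.  HONEST FRAMING: semi-synthetic model,
consistency evidence only; `η̈ := log(Ü)` is NOT print's `η̈^Θ` (which restricts to `log(Θ)` on `Δ_Θ`); nothing of
[EtTh] is asserted; no side is taken on [IUTchIII] Cor. 3.12; typed ≠ proved.
-/

noncomputable section

open Topology

namespace Literature.AnabelianGeometry.EtaleTheta

open scoped IsMulCommutative

/-! ### Generic `ContH1` bricks (general action `φ`) -/

namespace ContH1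

variable {G G' : Type*} [Group G] [TopologicalSpace G]
  [Group G'] [TopologicalSpace G'] [IsTopologicalGroup G']
  {φ : G →* G'} {A' : Subgroup G'} [A'.Normal] [IsMulCommutative A'] {H : Subgroup G}

/-- Cohomologous cocycles agree at every `x ∈ H` whose image `φ x` centralises the coefficients (general action
through `φ`; unbundled-element form of abc-iut-f-139's `apply_eq_of_mk_eq_mk`). [cite: NeukirchSchmidtWingberg2008, I §2 and II §7] -/
theorem apply_eq_of_mk_eq_mk_of_conj_eq {f g : H → A'} {hf : f ∈ contCocycles φ A' H}
    {hg : g ∈ contCocycles φ A' H} (hfg : ContH1.mk f hf = ContH1.mk g hg) {x : G} (hxH : x ∈ H)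
    (hx : ∀ a : A', MulAut.conjNormal (φ x) a = a) : f ⟨x, hxH⟩ = g ⟨x, hxH⟩ := by
  obtain ⟨a, ha⟩ := (ContH1.mk_eq_mk_iff H f g hf hg).mp hfg
  have h1 := ha ⟨x, hxH⟩
  rw [hx a, mul_inv_cancel, inv_mul_eq_one] at h1
  exact h1

/-- A cocycle is multiplicative on an element whose image centralises the coefficients: `f(x·x) = f(x)²`.
[cite: NeukirchSchmidtWingberg2008, I §2 and II §7] -/
theorem apply_mul_self_of_conj_eq {f : H → A'} (hf : f ∈ contCocycles φ A' H) (x : H)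
    (hx : ∀ a : A', MulAut.conjNormal (φ (x : G)) a = a) : f (x * x) = f x * f x := by
  rw [hf.2 x x, hx]

/-- Restriction on classes of cocycles is restriction of the cocycle (definitional).
[cite: NeukirchSchmidtWingberg2008, I §2 and II §7] -/
theorem res_mk {H₁ H₂ : Subgroup G} (h : H₁ ≤ H₂) (f : H₂ → A') (hf : f ∈ contCocycles φ A' H₂) :
    ContH1.res φ A' h (ContH1.mk f hf) =
      ContH1.mk (fun x : H₁ => f ⟨x.1, h x.2⟩) (ContH1.resCocycle φ A' h ⟨f, hf⟩).2 := rfl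

/-- Inflation on classes of cocycles is pull-back of the cocycle (definitional).
[cite: NeukirchSchmidtWingberg2008, I §2 and II §7] -/
theorem infl_mk {G₀ : Type*} [Group G₀] [TopologicalSpace G₀] (ψ : G₀ →* G') (hψ : Continuous ψ)
    {H₀ : Subgroup G₀} {H' : Subgroup G'} (h : H₀.map ψ ≤ H') (f : H' → A')
    (hf : f ∈ contCocycles (MonoidHom.id G') A' H') :
    ContH1.infl A' ψ hψ h (ContH1.mk f hf) =
      ContH1.mk (fun x : H₀ => f ⟨ψ x.1, h ⟨x.1, x.2, rfl⟩⟩) (ContH1.inflCocycle A' ψ hψ h ⟨f, hf⟩).2 := rfl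

end ContH1

/-! ### Generic [EtTh] §1 brick: Kummer cocycles of constants vanish at geometric elements (any subgroup) -/

namespace ThetaSetting.KummerCore

variable {p : ℕ} [Fact p.Prime] {D : ThetaSetting p} (C : D.KummerCore)

/-- **Kummer cocycles of constants vanish at geometric elements**, for the tree's continuous Kummer map at ANY
subgroup `H' ≤ (Π^tp_X)^Θ` (coefficients `Λ(ℚ̄_p^×) → Δ_Θ` of a Kummer core, action through `augTheta`): any
cocycle representing `κ(a)` takes the value `1` at every `x ∈ H'` with `augTheta x = 1` that centralises `Δ_Θ`.
(Generic form; `H' = (Π^tp_Ÿ)^Θ` is abc-iut-f-139's `apply_eq_one_of_kumYdd_eq_mk` in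
`Discharge/Sec1Thm16Prop15ClosuresModelChi.lean`, `H' = (Π^tp_Y)^Θ` is `apply_eq_one_of_kumY_eq_mk` in
`Discharge/Sec1Rmk131ModelChiNoHalf.lean`; `kumY`/`kumYdd` of `KummerCore.toKummerData` ARE `kummerContMap` by `rfl`.) [cite: MochizukiEtTh2009, Prop 1.3 p.21] -/
theorem kummerContMap_apply_eq_one (H' : Subgroup D.GtpTheta) :
    letI := D.unitsAction C.augTheta
    ∀ (a : ↥(invariants (A := (PadicAlgCl p)ˣ) H')) {f : H' → ↥D.DeltaTheta}
      {hf : f ∈ contCocycles (MonoidHom.id D.GtpTheta) D.DeltaTheta H'}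
      (_ : C.coeff.kummerContMap H' C.isOpen_stabilizer' a = ContH1.mk f hf) (x : H')
      (_ : C.augTheta (x : D.GtpTheta) = 1) (_ : ∀ d : ↥D.DeltaTheta, MulAut.conjNormal (x : D.GtpTheta) d = d),
      f x = 1 := by
  letI := D.unitsAction C.augTheta
  intro a f hf h x haug hcen
  have h1 : C.coeff.kummerContMap H' C.isOpen_stabilizer' a =
      ContH1.mk (fun h => C.coeff.hom ((RootSystem.ofRootableBy (a : (PadicAlgCl p)ˣ)).kummerCocycle a.2 h))
        (C.coeff.kummerContCocycle _ (RootSystem.ofRootableBy (a : (PadicAlgCl p)ˣ)) a.2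
          (fun _ => C.isOpen_stabilizer' _)).2 := rfl
  rw [h1] at h
  have h2 := ContH1.apply_eq_of_mk_eq_mk_conj h x hcen
  rw [← h2]
  have h3 : (RootSystem.ofRootableBy (a : (PadicAlgCl p)ˣ)).kummerCocycle a.2 x = 1 := by
    refine Subtype.ext (funext fun n => ?_)
    rw [RootSystem.kummerCocycle_apply]
    change C.augTheta (x : D.GtpTheta) • (RootSystem.ofRootableBy (a : (PadicAlgCl p)ˣ)).root n /
      (RootSystem.ofRootableBy (a : (PadicAlgCl p)ˣ)).root n = _
    rw [haug, one_smul, div_self']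
    rfl
  rw [h3, map_one]

end ThetaSetting.KummerCore

namespace SettingModel

open Literature.AnabelianGeometry.SemiGraphs ThetaSetting

variable (p : ℕ) [Fact p.Prime]

/-! ### The geometric test elements `b ∈ Π^tp_Y`, `b² ∈ Π^tp_Ÿ` at the tempered level -/

/-- `ι(1) · ι(1) = ι(2)` in `Ẑ`. [cite: RibesZalesskii2010, Thm 2.7.1] -/
theorem iotaZ_one_mul_iotaZ_one :
    iotaZ (Multiplicative.ofAdd 1) * iotaZ (Multiplicative.ofAdd 1) = iotaZ (Multiplicative.ofAdd (2 : ℤ)) := by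
  rw [← map_mul, ← ofAdd_add]
  norm_num

/-- `(b, 0) ⋊ 1 · (b, 0) ⋊ 1 = (b², 0) ⋊ 1` in `Π^tp_X(modelχ)`. [cite: MochizukiEtTh2009, §1 p.12] -/
theorem inl_b_mul_inl_b :
    (SemidirectProduct.inl (bPowGfp (iotaZ (Multiplicative.ofAdd 1))) : PiTpχ p) *
        SemidirectProduct.inl (bPowGfp (iotaZ (Multiplicative.ofAdd 1))) =
      SemidirectProduct.inl (bPowGfp (iotaZ (Multiplicative.ofAdd (2 : ℤ)))) := by
  rw [← map_mul, ← map_mul, iotaZ_one_mul_iotaZ_one]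

/-- `half ⟨ι(2), _⟩ = ι(1)`: the halved `y`-coordinate of `b²` is `ι(1)`. [cite: RibesZalesskii2010, Thm 2.7.1] -/
theorem half_iotaZ_two (h : iotaZ (Multiplicative.ofAdd (2 : ℤ)) ∈ sqHom.range) :
    half ⟨iotaZ (Multiplicative.ofAdd (2 : ℤ)), h⟩ = iotaZ (Multiplicative.ofAdd 1) := by
  apply sqHom_injective
  rw [sqHom_apply, sqHom_apply, half_sq, pow_two, iotaZ_one_mul_iotaZ_one]

/-- The tempered element `b² ∈ Π^tp_Ÿ` maps into `(Π^tp_Ÿ)^Θ`. [cite: MochizukiEtTh2009, §1 p.17] -/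
theorem toTheta_inl_b_sq_mem_gtpYdd_map :
    (ThetaSetting.modelχ p).toTheta (SemidirectProduct.inl (bPowGfp (iotaZ (Multiplicative.ofAdd (2 : ℤ))))) ∈
      (ThetaSetting.modelχ p).GtpYdd.map (ThetaSetting.modelχ p).toTheta :=
  ⟨_, inl_bPowGfp_two_mem_gtpYdd p, rfl⟩

/-- The `log(Ü)`-cocycle takes the value `c^{ι(1)} = c` at `b²` (`ŷ(b²)/2 = ι(1)`). [cite: MochizukiEtTh2009, Prop 1.5 p.23] -/
theorem logUddFunχ_inl_b_sq :
    logUddFunχ p ⟨_, toTheta_inl_b_sq_mem_gtpYdd_map p⟩ = deltaThetaCoordχ p (iotaZ (Multiplicative.ofAdd 1)) := by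
  have hy : yThetaχ p ((ThetaSetting.modelχ p).toTheta
      (SemidirectProduct.inl (bPowGfp (iotaZ (Multiplicative.ofAdd (2 : ℤ)))))) =
        iotaZ (Multiplicative.ofAdd (2 : ℤ)) := by
    show yThetaχ p (CurveTheta.toTheta (curveχ p) _) = _
    rw [yThetaχ_toTheta, yCoordχ_inl_bPowGfp]
  show deltaThetaCoordχ p (half ⟨yThetaχ p ((ThetaSetting.modelχ p).toTheta _), _⟩) = _
  congr 1
  have hmem : iotaZ (Multiplicative.ofAdd (2 : ℤ)) ∈ sqHom.range := hy ▸ yThetaχ_mem_range_sqHom p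
    (toTheta_inl_b_sq_mem_gtpYdd_map p)
  rw [← half_iotaZ_two hmem]
  congr 1
  exact Subtype.ext hy

/-! ### The core computation: no unit translate of `log(Ü)` descends to `Π^tp_Y` -/

/-- **No unit Kummer translate of `log(Ü)` is a restriction from `Π^tp_Y`** (tempered level, over the genuine Kummer
datum `kummerDataχ`): for every `a ∈ O^×_{K/K̈}` and every class `x ∈ H¹(Π^tp_Y, Δ_Θ)`,
`infl κ(a) · infl log(Ü) ≠ x|_Ÿ`.  (At `b² ∈ Π^tp_Ÿ`: `κ(a) ↦ 1`, `log(Ü) ↦ c`, `x ↦ x(b)²`; `c` is not a square.)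
[cite: MochizukiEtTh2009, Rmk 1.3.1 p.21] -/
theorem kumUnitsModHom_mul_infl_logUddχ_ne_res (a : (ThetaSetting.modelχ p).unitsOKmodKdd)
    (x : (ThetaSetting.modelχ p).H1 (ThetaSetting.modelχ p).GtpY) :
    (kummerDataχ p).kumUnitsModHom a *
        (ThetaSetting.modelχ p).inflTheta (ThetaSetting.modelχ p).GtpYdd (logUddχ p) ≠
      ContH1.res (ThetaSetting.modelχ p).toTheta (ThetaSetting.modelχ p).DeltaTheta
        (ThetaSetting.modelχ p).GtpYdd_le_GtpY x := by
  intro h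
  rw [KummerData.kumUnitsModHom_apply, ← map_mul] at h
  obtain ⟨g, hg, hgeq⟩ := ContH1.exists_mk_eq ((kummerDataχ p).kumYdd ((kummerDataχ p).toKddHat (a : _)))
  obtain ⟨f, hf, rfl⟩ := ContH1.exists_mk_eq x
  rw [← hgeq, logUddχ, ContH1.mk_mul_mk, ThetaSetting.inflTheta, ContH1.infl_mk, ContH1.res_mk] at h
  -- evaluate at the tempered element `b² ∈ Π^tp_Ÿ`
  have hB2 := inl_bPowGfp_two_mem_gtpYdd p
  have hcen : ∀ d : (ThetaSetting.modelχ p).DeltaTheta,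
      MulAut.conjNormal ((ThetaSetting.modelχ p).toTheta
        (SemidirectProduct.inl (bPowGfp (iotaZ (Multiplicative.ofAdd (2 : ℤ)))))) d = d :=
    fun d => conjNormal_toTheta_eq_self p (SemidirectProduct.right_inl _) d
  have key := ContH1.apply_eq_of_mk_eq_mk_of_conj_eq h hB2 hcen
  -- left factor: the Kummer cocycle of the constant vanishes at `b²`
  have hgx : g ⟨_, toTheta_inl_b_sq_mem_gtpYdd_map p⟩ = 1 :=
    (kummerCoreχ p).kummerContMap_apply_eq_one _ _ hgeq.symm ⟨_, toTheta_inl_b_sq_mem_gtpYdd_map p⟩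
      ((kummerCoreχ p).augTheta_toTheta _) hcen
  -- right side: `f(b²) = f(b)²`
  have hbY := inl_bPowGfp_mem_gtpY p (iotaZ (Multiplicative.ofAdd 1))
  have hff : f ⟨SemidirectProduct.inl (bPowGfp (iotaZ (Multiplicative.ofAdd (2 : ℤ)))),
      (ThetaSetting.modelχ p).GtpYdd_le_GtpY hB2⟩ =
        f ⟨_, hbY⟩ * f ⟨_, hbY⟩ := by
    rw [← ContH1.apply_mul_self_of_conj_eq hf ⟨_, hbY⟩
      (fun d => conjNormal_toTheta_eq_self p (SemidirectProduct.right_inl _) d)]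
    congr 1
    exact Subtype.ext (inl_b_mul_inl_b p).symm
  dsimp only at key
  erw [Pi.mul_apply, hgx, one_mul, logUddFunχ_inl_b_sq, hff, ← pow_two] at key
  exact sq_ne_deltaThetaCoordχ_iotaZ_one p _ key.symm

/-! ### `Rmk131` as typed at étale-theta data over `kummerDataχ` -/

/-- **F-0523 instance form — Rmk. 1.3.1 as typed HOLDS** for abc-iut-L2-t6's étale-theta datum over the genuine
Kummer datum `kummerDataχ` with `η̈ := log(Ü)` (inflated to `Π^tp_Ÿ`) and honest-degenerate `½`-groups: no unit
translate of `η̈` descends to `Y`. [cite: MochizukiEtTh2009, Rmk 1.3.1 p.21] -/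
theorem rmk131_etaleThetaDataOfClass_infl_logUddχ :
    Rmk131 ((kummerDataχ p).etaleThetaDataOfClass
      ((ThetaSetting.modelχ p).inflTheta (ThetaSetting.modelχ p).GtpYdd (logUddχ p))) := by
  rw [KummerData.rmk131_etaleThetaDataOfClass_iff]
  exact kumUnitsModHom_mul_infl_logUddχ_ne_res p

/-- … whereas for `η̈ := 1` (a class that trivially descends) Rmk. 1.3.1 as typed FAILS at the same Kummer datum
(abc-iut-L2-t6's `not_rmk131_etaleThetaDataOfClass_of_res_eq`). [cite: MochizukiEtTh2009, Rmk 1.3.1 p.21] -/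
theorem not_rmk131_etaleThetaDataOfClass_one :
    ¬ Rmk131 ((kummerDataχ p).etaleThetaDataOfClass 1) := by
  rw [KummerData.rmk131_etaleThetaDataOfClass_iff]
  intro h
  exact h 1 1 (by rw [map_one, one_mul, map_one])

/-- Comm-group bookkeeping for the dichotomy: from `k·η = r` and `k'·(η·L) = r'` get `k'·k⁻¹·L = r'·r⁻¹`.
[cite: NeukirchSchmidtWingberg2008, I §2 and II §7] -/
private theorem mul_inv_mul_eq_of_eq_of_eq {M : Type*} [CommGroup M] {k k' η L r r' : M}
    (hx : k * η = r) (hx' : k' * (η * L) = r') : k' * k⁻¹ * L = r' * r⁻¹ := by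
  subst hx hx'
  rw [mul_inv_rev, mul_assoc k', mul_assoc k', mul_comm η L, mul_assoc L η, mul_inv_cancel_left, mul_comm L]

/-- **The `½`-dichotomy**: for EVERY class `η̈ ∈ H¹(Π^tp_Ÿ, Δ_Θ)`, Rmk. 1.3.1 as typed holds over `kummerDataχ` for
`η̈` OR for `η̈ · log(Ü)` — if unit translates of both descended to `Y`, so would a unit translate of their quotient
`log(Ü) = ½·log(U)`. [cite: MochizukiEtTh2009, Rmk 1.3.1 p.21] -/
theorem rmk131_etaleThetaDataOfClass_or_mul_logUddχ
    (η : (ThetaSetting.modelχ p).H1 (ThetaSetting.modelχ p).GtpYdd) :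
    Rmk131 ((kummerDataχ p).etaleThetaDataOfClass η) ∨
      Rmk131 ((kummerDataχ p).etaleThetaDataOfClass
        (η * (ThetaSetting.modelχ p).inflTheta (ThetaSetting.modelχ p).GtpYdd (logUddχ p))) := by
  rw [KummerData.rmk131_etaleThetaDataOfClass_iff, KummerData.rmk131_etaleThetaDataOfClass_iff]
  by_contra h
  rw [not_or, not_forall, not_forall] at h
  obtain ⟨⟨a, ha⟩, ⟨a', ha'⟩⟩ := h
  rw [not_forall] at ha ha'
  obtain ⟨x, hx⟩ := ha
  obtain ⟨x', hx'⟩ := ha'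
  rw [not_not] at hx hx'
  apply kumUnitsModHom_mul_infl_logUddχ_ne_res p (a' * a⁻¹) (x' * x⁻¹)
  rw [map_mul, map_inv, map_mul, map_inv]
  exact mul_inv_mul_eq_of_eq_of_eq hx hx'

/-- Both truth values of the typed Rmk. 1.3.1 occur at étale-theta data over the ONE genuine Kummer datum
`kummerDataχ` (with `η̈ := log(Ü)`, resp. `η̈ := 1`): at a named datum the row is a property of the class `η̈`.
[cite: MochizukiEtTh2009, Rmk 1.3.1 p.21] -/
theorem exists_rmk131_and_exists_not_rmk131_kummerDataχ :
    (∃ E : (ThetaSetting.modelχ p).EtaleThetaData, E.toKummerData = kummerDataχ p ∧ Rmk131 E ∧ Prop13 E) ∧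
      ∃ E : (ThetaSetting.modelχ p).EtaleThetaData, E.toKummerData = kummerDataχ p ∧ ¬ Rmk131 E ∧ Prop13 E :=
  ⟨⟨_, rfl, rmk131_etaleThetaDataOfClass_infl_logUddχ p, (kummerDataχ p).prop13_etaleThetaDataOfClass _⟩,
    ⟨_, rfl, not_rmk131_etaleThetaDataOfClass_one p, (kummerDataχ p).prop13_etaleThetaDataOfClass _⟩⟩

/-! ### The same at abc-iut-L2-t6's F7b datum `etaleThetaDataχSec` (section Kummer datum; appended, same seat) -/

/-- The SECTION Kummer datum has the same unit Kummer classes on `Π^tp_Ÿ` as the core datum (L2-t6's retraction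
`KummerCore.kumOfSection_toKddHatOfSection`: a Kummer cocycle factors through `augTheta`, and `augTheta ∘ inr = id`).
[cite: MochizukiEtTh2009, Prop 1.5 p.23] -/
theorem kumUnitsModHom_kummerDataχSec (a : (ThetaSetting.modelχ p).unitsOKmodKdd) :
    (kummerDataχSec p).kumUnitsModHom a = (kummerDataχ p).kumUnitsModHom a := by
  rw [KummerData.kumUnitsModHom_apply, KummerData.kumUnitsModHom_apply]
  exact congrArg ((ThetaSetting.modelχ p).inflTheta (ThetaSetting.modelχ p).GtpYdd)
    ((kummerCoreχ p).kumOfSection_toKddHatOfSection SemidirectProduct.inr (continuous_inr_modelχ p)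
      (aug_modelχ_inr p) (map_inr_GKdd_le_GtpYdd_modelχ p) (a : (↥(ThetaSetting.modelχ p).Kdd)ˣ))

/-- At the F7b datum: no unit translate of `log(Ü)` descends to `Π^tp_Y`. [cite: MochizukiEtTh2009, Rmk 1.3.1 p.21] -/
theorem kumUnitsModHom_kummerDataχSec_mul_infl_logUddχ_ne_res (a : (ThetaSetting.modelχ p).unitsOKmodKdd)
    (x : (ThetaSetting.modelχ p).H1 (ThetaSetting.modelχ p).GtpY) :
    (kummerDataχSec p).kumUnitsModHom a *
        (ThetaSetting.modelχ p).inflTheta (ThetaSetting.modelχ p).GtpYdd (logUddχ p) ≠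
      ContH1.res (ThetaSetting.modelχ p).toTheta (ThetaSetting.modelχ p).DeltaTheta
        (ThetaSetting.modelχ p).GtpYdd_le_GtpY x := by
  rw [kumUnitsModHom_kummerDataχSec]
  exact kumUnitsModHom_mul_infl_logUddχ_ne_res p a x

/-- **Rmk. 1.3.1 as typed HOLDS at abc-iut-L2-t6's F7b datum `etaleThetaDataχSec p η̈` for `η̈ := log(Ü)`**
(section Kummer datum `KddHat := H¹(G_{ℚ_p}, Δ_Θ)`, honest-degenerate `½`-groups). [cite: MochizukiEtTh2009, Rmk 1.3.1 p.21] -/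
theorem rmk131_etaleThetaDataχSec_infl_logUddχ :
    Rmk131 (etaleThetaDataχSec p
      ((ThetaSetting.modelχ p).inflTheta (ThetaSetting.modelχ p).GtpYdd (logUddχ p))) := by
  show Rmk131 ((kummerDataχSec p).etaleThetaDataOfClass _)
  rw [KummerData.rmk131_etaleThetaDataOfClass_iff]
  exact kumUnitsModHom_kummerDataχSec_mul_infl_logUddχ_ne_res p

/-- … and FAILS at the same datum for `η̈ := 1` (the inhabitant L2-t6 used for `nonempty_etaleThetaData_modelχ`).
[cite: MochizukiEtTh2009, Rmk 1.3.1 p.21] -/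
theorem not_rmk131_etaleThetaDataχSec_one : ¬ Rmk131 (etaleThetaDataχSec p 1) := by
  show ¬ Rmk131 ((kummerDataχSec p).etaleThetaDataOfClass 1)
  rw [KummerData.rmk131_etaleThetaDataOfClass_iff]
  intro h
  exact h 1 1 (by rw [map_one, one_mul, map_one])

/-- **The `½`-dichotomy at the F7b datum**: for every `η̈`, Rmk. 1.3.1 as typed holds for `etaleThetaDataχSec p η̈`
or for `etaleThetaDataχSec p (η̈ · log(Ü))`. [cite: MochizukiEtTh2009, Rmk 1.3.1 p.21] -/
theorem rmk131_etaleThetaDataχSec_or_mul_logUddχ (η : (ThetaSetting.modelχ p).H1 (ThetaSetting.modelχ p).GtpYdd) :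
    Rmk131 (etaleThetaDataχSec p η) ∨
      Rmk131 (etaleThetaDataχSec p
        (η * (ThetaSetting.modelχ p).inflTheta (ThetaSetting.modelχ p).GtpYdd (logUddχ p))) := by
  show Rmk131 ((kummerDataχSec p).etaleThetaDataOfClass _) ∨ Rmk131 ((kummerDataχSec p).etaleThetaDataOfClass _)
  rw [KummerData.rmk131_etaleThetaDataOfClass_iff, KummerData.rmk131_etaleThetaDataOfClass_iff]
  by_contra h
  rw [not_or, not_forall, not_forall] at h
  obtain ⟨⟨a, ha⟩, ⟨a', ha'⟩⟩ := h
  rw [not_forall] at ha ha'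
  obtain ⟨x, hx⟩ := ha
  obtain ⟨x', hx'⟩ := ha'
  rw [not_not, kumUnitsModHom_kummerDataχSec] at hx hx'
  apply kumUnitsModHom_mul_infl_logUddχ_ne_res p (a' * a⁻¹) (x' * x⁻¹)
  rw [map_mul, map_inv, map_mul, map_inv]
  exact mul_inv_mul_eq_of_eq_of_eq hx hx'

/-- CENSUS at the F7b datum: both truth values of the typed Rmk. 1.3.1 occur among the `etaleThetaDataχSec p η̈`
(each with `Prop13`, L2-t6's `prop13_etaleThetaDataχSec`). [cite: MochizukiEtTh2009, Rmk 1.3.1 p.21] -/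
theorem exists_rmk131_and_exists_not_rmk131_etaleThetaDataχSec :
    (∃ η : (ThetaSetting.modelχ p).H1 (ThetaSetting.modelχ p).GtpYdd,
        Rmk131 (etaleThetaDataχSec p η) ∧ Prop13 (etaleThetaDataχSec p η)) ∧
      ∃ η : (ThetaSetting.modelχ p).H1 (ThetaSetting.modelχ p).GtpYdd,
        ¬ Rmk131 (etaleThetaDataχSec p η) ∧ Prop13 (etaleThetaDataχSec p η) :=
  ⟨⟨_, rmk131_etaleThetaDataχSec_infl_logUddχ p, prop13_etaleThetaDataχSec p _⟩,
    ⟨1, not_rmk131_etaleThetaDataχSec_one p, prop13_etaleThetaDataχSec p 1⟩⟩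

end SettingModel

end Literature.AnabelianGeometry.EtaleTheta

end
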